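import Literature.MathematicalPhysics.QuantumFieldTheory.Balaban1983to89.B9GradViaDivLettersAtPins
import Literature.MathematicalPhysics.QuantumFieldTheory.Balaban1983to89.B9CoReadingCoordsInput
import Literature.MathematicalPhysics.QuantumFieldTheory.Balaban1983to89.B9Thm312WholeClasses

/-!
# `Balaban1983to89.B9DivViaGradLettersAtPins` — [B9] (3.8) p. 392 ∕ (3.3) p. 390 at node00-def-Y's letters: THE COVARIANT DIVERGENCE OF THE GAUGE SECTOR IS A
# FINITE SUM OF THE BOND-SECTOR DIRECTION LETTERS ∇_{U,ν} FOLLOWED BY ONE-NEIGHBOUR TRANSPORTED READINGS, `D*_U = Σ_ν J†_ν(U) ∘ ∇_{U,ν}` — the DIVERGENCE TWIN of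
# dag-n06-l's `B9GradViaDivLettersAtPins` (`D_U = Σ_μ ∇*_{U,μ} ∘ J_μ(U)`); the coordinate model at the N06 certificate's pins (`DvscoKH = Σ_ν JTcoKH ν ∘ Dd ν`), the
# sup majorant of `J†_ν`, and the growth of the input Hölder class `bHK ε` in its exponent

T. Bałaban, *Propagators for lattice gauge theories in a background field*, Commun. Math. Phys. **99** (1985) 389–434
[`Balaban1985BackgroundPropagators`, "B9"]; [4] = T. Bałaban, *Propagators and renormalization transformations for lattice gauge
theories. II*, Commun. Math. Phys. **96** (1984) 223–250 [`Balaban1984PropagatorsII`].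

statement-level skeleton of published theorems with citation tags; proofs where landed; nothing here is a claim about the Yang–Mills
mass gap

THE PRINTED LOCI (held text `paper:balaban1985-cmp99-background-propagators`).  (3.8) p. 392 (the adjoint derivatives `D*_U`, `∇*_{U,μ}` along reversed bonds;
componentwise `(D*_UA)(x) = Σ_μ (∇*_{U,μ}A_μ)(x)` up to units); (3.5) p. 391 (`U(x, x−e_μ) = U(x−e_μ, x)⁻¹`); (3.3) p. 390; p. 398 (remark after (3.47)): *"we may
always replace ∇_U by ∇*_U, and vice versa, in arbitrary place and combination"* — on the lattice `∇*_{U,ν} = −𝒯_ν ∘ ∇_{U,ν}` with `𝒯_ν` the unit back-shift transported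
by the inverse link variable; (3.40) p. 397 (the Hölder norm, pairs weighted by `|x − x′|^{−α}`); [4] (2.45)–(2.46) p. 231, (2.51) p. 232 (block maps and majorants).

THE POINT.  `B9Thm33G0DivRFromDir.h44Ds_of_h44m` (width seat w5) turns the displayed field `Thm33G0DivR.h44Ds` (`D*_U G₀ ∇*_{U,μ}`, W-c face `hdiv` of the N06 certificate)
into a theorem of the rows-19-derived `Thm33G0Dir.h44m` modulo THREE hypotheses: `hDs : 𝔬.Dvstar U = Σ_ν JT ν ∘ₗ Dd U ν`, a one-neighbour sup majorant `hJT` of the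
`JT ν`, and the growth `hdom` of the input family in its Hölder exponent.  THIS FILE discharges all three at node00-def-Y's GENUINE letters and the certificate's pins
(`hDvsco12 : (𝔬12 x).Dvstar U = DvscoKH …`, `h𝔡Ad : (𝔡A x).Dd U = fun ν => coordOpK (trBasis N) (fun _ => cdBₗ … U ν)`, `hblk12 ∕ hblkW12 ∕ hβ1 ∕ hbHXA`, ed. 29∕30):
* §1 the 𝔸-level letter ★ `JTb i U ν : (FBondY i → 𝔸) →ₗ[ℂ] (SiteY i → 𝔸)`, `(J†_νF)(z) = −R(U_ν(chart⁻¹z − e_ν))⁻¹·F(⟨chart⁻¹z − e_ν, ν⟩)` (one transported neighbour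
  value, the `ν`-component only), `cdB_apply'`, and ★★ `divY_apply_eq_sum_JTb_cdB` ∕ `divY_restrict_eq_sum`: `D*_U = Σ_ν J†_ν(U) ∘ ∇_{U,ν}` EXACTLY (def-Y's `divY`
  against def-Y's componentwise `cdB`; via `OpsYNablaBridge.divY_apply_eq_sum_cdsS` and the cancellation `R(U)⁻¹R(U) = 1` of (3.5));
* §2 the coordinate models: `coordOpKH_comp_coordOpK` (the mixed model after a slice-diagonal model), ★ `JTcoKH := coordOpKH b (fun _ => J†_ν)`, ★★ `DvscoKH_eq_sum`
  (`DvscoKH = Σ_ν JTcoKH ν ∘ₗ coordOpK b (fun _ => cdBₗ ν)` — the certificate's `hDs` after `hDvsco12 ∕ h𝔡Ad`);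
* §3 the sup majorant: `J†_ν` reads ONE transported neighbour value, so for contracting link variables `|(J†_νF)(z, slot, c, c′)| ≤ cR39 b · |F|` on the index block of the
  back-shifted bond `⟨chart⁻¹z − e_ν, ν⟩`, which is within `rJ = (d+1)(L+1)+2` of the site block `sIK bI z` (dag-n06-l `dist_bI_sIK_shift_le` under the 1-faithfulness pin
  `hβ1`, distance symmetrised): ★ `abs_JTcoKH_apply_le`, ★★ `hasMajorantHom_JTcoKH`, ★★ `hasMaj_JTcoKH` (the `hJT` shape: `HasMaj (ofBlocks (blkBK bI)) (cNormR R₀ H₀ (blkSK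
  (sIK bI)) _ 0) (J†_ν) (cR39 b·e^{δ·rJ}·e^{−δd})`, every `δ ≥ 0`), ★★ `hasMaj_JTcoKH_pins` (every member, every `Reg335` U, at `trBasis N`);
* §4 the input family: `holK_mono` (the ξ-Hölder part of `bHK ε` grows with `ε > 0`, since `tpar ≤ 1` on `Adm` pairs), ★ `bHK_dom` (the `hdom` shape: same localisation,
  `(bHK 1).loc ≤ (bHK ε).loc` for `1 ≤ ε`).

HONEST SCOPE.  Instance-side kinematic bookkeeping at def-Y's letters: one exact identity of lattice calculus, the sup size of a one-term transported shift, a monotonicity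
of a typed norm; nothing of [B9]'s propagator estimates asserted; COUNT-NEUTRAL; N06 NOT discharged; one finite lattice at a time; nothing continuum, nothing about the
mass gap ∕ Clay.  Cell `pub-ymgap` (HUMAN RULING D-0062 ∕ D-0154), Track A node N06 [B9], width seat `pub-ymgap-dag-n06-w5` (g0′), 2026-08-28.
-/

noncomputable section

namespace Literature.MathematicalPhysics.QuantumFieldTheory.Balaban1983to89.B9DivViaGradLettersAtPins

open Node00 B6GlobalChartV1 B6KLevelCensusIndexV1 B9BackgroundsKLevelV1
open B9Eq39Adjoint (R R_zero R_neg R_inv_R R_add R_sub R_smul)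
open Node00.OpsYNablaBridge (chartY shiftY_chartY shiftY_symm_chartY divY_apply_eq_sum_cdsS cdsS_apply bondCompY bondCompY_apply shift_unshift unshift_shift)
open B9CoReadingCoords (XBK coordOpK cdBₗ cdsBₗ cdBₗ_apply assembleK blkBK coordOpK_apply assembleK_coordOpK)
open B9CoReadingCoordsH (coordOpKH coordOpKH_apply)
open B9CoReadingCoordsS (XSK blkSK sIK)
open B9CoReadingCoordsInput (bHK supK holK restrK)
open B9GradViaDivLettersAtPins (coordOpKH_fsum rJ dist_bI_sIK_shift_le cfg_norm_le_one_of_reg335)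
open Node00.OpsYSectDCoords (DvscoKH)
open LatticeFieldCalculus (supDist)
open B6Geom246MultiLevelTorus (geomT)
open B6Ineq2142KLevelV1 (β lvl)
open B9GeoNormsKLevelV1 (geo9K)
open B9GeoLemma21KLevelV1 (geo9Y_dist_comm)
open B9CoRealizesRelAtLetters (RelB)
open B9Thm39ReadingCoords (cR39 cR39_nonneg coordBound39 basisBound39 abs_repr_le norm_sum_smul_basis_le)
open B9Thm34Ext (toB6)
open B9SectDSup (weightNorm)
open B11SectG (HasMaj BlockNorm)
open B9Thm312WholeClasses (cNormR cNormR_loc)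
open B6RandomWalkHom (HasMajorantHom)

variable {𝔸 : Type} [NormedRing 𝔸] [NormedAlgebra ℂ 𝔸] [CompleteSpace 𝔸]
variable {d ℓ : ℕ} {hd : 1 ≤ d + 1} {hL : Odd (ℓ + 1) ∧ 1 < ℓ + 1} {b₀ b₁ : ℝ}
variable (i : KIdx d ℓ hd hL b₀ b₁)

/-! ## §1 The 𝔸-level letter `J†_ν(U)` and the identity `D*_U = Σ_ν J†_ν(U) ∘ ∇_{U,ν}` -/

/-- ★ **THE TRANSPOSED KINEMATIC READING `J†_ν(U)`: vector (bond) functions → scalar (site) functions** — `(J†_νF)(z) = −R(U_ν(x − e_ν))⁻¹·F(⟨x − e_ν, ν⟩)`, `x = chart⁻¹z`: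
the `ν`-component of `F` at the back-shifted bond, transported to `x` by the inverse link variable (so that `J†_ν ∘ ∇_{U,ν}` is the `ν`-th term of `D*_U`, p. 398's
*"replace ∇_U by ∇*_U"* made an operator identity; the transpose twin of dag-n06-l's `Jb`). [cite: Balaban1985BackgroundPropagators, (3.8) p.392, (3.5) p.391, p.398 (remark after (3.47))] -/
def JTb (U : CfgY 𝔸 i) (ν : Fin (d + 1)) : (FBondY i → 𝔸) →ₗ[ℂ] (SiteY i → 𝔸) where
  toFun F := fun z => -R (U ν (((chartY i).symm z).unshift ν))⁻¹ (F ⟨((chartY i).symm z).unshift ν, ν⟩)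
  map_add' F G := by
    funext z
    simp only [Pi.add_apply, R_add, neg_add_rev]
    abel
  map_smul' c F := by
    funext z
    simp only [Pi.smul_apply, R_smul, smul_neg, RingHom.id_apply]

/-- `J†_ν(U)`, evaluated. [cite: Balaban1985BackgroundPropagators, (3.8) p.392, bookkeeping] -/
theorem JTb_apply (U : CfgY 𝔸 i) (ν : Fin (d + 1)) (F : FBondY i → 𝔸) (z : SiteY i) :
    JTb i U ν F z = -R (U ν (((chartY i).symm z).unshift ν))⁻¹ (F ⟨((chartY i).symm z).unshift ν, ν⟩) := rfl

/-- def-Y's `cdB` unfolded at a bond: `(∇_{U,μ}A)_ν(x) = c_f·(R(U_μ(x))A_ν(x + e_μ) − A_ν(x))`. [cite: Balaban1985BackgroundPropagators, (3.3) p.390, bookkeeping] -/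
theorem cdB_apply' (U : CfgY 𝔸 i) (μ : Fin (d + 1)) (A : FBondY i → 𝔸) (b : FBondY i) :
    cdB i U μ A b = ((i.cf : ℝ) : ℂ) • (R (U μ b.src) (A ⟨b.src.shift μ, b.dir⟩) - A b) := by
  rfl

/-- ★★ **(3.8) AS A SUM OVER THE DIRECTION LETTERS OF (3.3): `(D*_UA)(z) = Σ_ν (J†_ν(U) ∇_{U,ν}A)(z)`** — per direction,
`−R(U_ν(x−e_ν))⁻¹·c_f·(R(U_ν(x−e_ν))A_ν(x) − A_ν(x−e_ν)) = c_f·(R(U_ν(x−e_ν))⁻¹A_ν(x−e_ν) − A_ν(x)) = c_f·(∇*_{U,ν}A_ν)(x)`, the transporters cancelling by (3.5).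
[cite: Balaban1985BackgroundPropagators, (3.8) p.392, (3.5) p.391, (3.3) p.390, p.398 (remark after (3.47))] -/
theorem divY_apply_eq_sum_JTb_cdB (U : CfgY 𝔸 i) (A : FBondY i → 𝔸) (z : SiteY i) :
    divY i U A z = ∑ ν : Fin (d + 1), JTb i U ν (cdB i U ν A) z := by
  obtain ⟨w, rfl⟩ := (chartY i).surjective z
  rw [divY_apply_eq_sum_cdsS, Finset.smul_sum]
  refine Finset.sum_congr rfl fun ν _ => ?_
  rw [cdsS_apply, shiftY_symm_chartY, Equiv.symm_apply_apply, bondCompY_apply, bondCompY_apply, Equiv.symm_apply_apply, Equiv.symm_apply_apply,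
    JTb_apply, Equiv.symm_apply_apply, cdB_apply']
  dsimp only
  rw [shift_unshift, R_smul, R_sub, R_inv_R, ← smul_neg, neg_sub]

/-- ★ **THE OPERATOR FORM: `D*_U = Σ_ν J†_ν(U) ∘ ∇_{U,ν}`** (ℝ-linear maps `(FBondY i → 𝔸) → (SiteY i → 𝔸)`; def-Y's `divY` against n06-d's ℝ-linear `cdBₗ`).
[cite: Balaban1985BackgroundPropagators, (3.8) p.392, (3.3) p.390, p.398 (remark after (3.47))] -/
theorem divY_restrict_eq_sum (U : CfgY 𝔸 i) :
    (divY i U).restrictScalars ℝ = ∑ ν : Fin (d + 1), (JTb i U ν).restrictScalars ℝ ∘ₗ cdBₗ i U ν := by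
  apply LinearMap.ext
  intro A
  funext z
  simp only [LinearMap.restrictScalars_apply, LinearMap.sum_apply, Finset.sum_apply, LinearMap.comp_apply, cdBₗ_apply]
  exact divY_apply_eq_sum_JTb_cdB i U A z

/-! ## §2 The coordinate models: `JTcoKH`, `DvscoKH = Σ_ν JTcoKH ν ∘ Dd ν` -/

section Coords

variable {κ : Type} [Fintype κ] (b : Module.Basis κ ℝ 𝔸)

omit [CompleteSpace 𝔸] in
/-- the mixed coordinate model AFTER a slice-diagonal model is the mixed model of the composite family. [cite: Balaban1985BackgroundPropagators, (3.126) p.420, dictionary; Balaban1984PropagatorsII, (2.51) p.232] -/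
theorem coordOpKH_comp_coordOpK {S S' D : Type} (T : D → (S' → 𝔸) →ₗ[ℝ] (S → 𝔸)) (T' : D → (S' → 𝔸) →ₗ[ℝ] (S' → 𝔸)) :
    coordOpKH b T ∘ₗ coordOpK b T' = coordOpKH b (fun ν => T ν ∘ₗ T' ν) := by
  apply LinearMap.ext; intro f; funext p
  simp only [LinearMap.comp_apply, coordOpKH_apply, assembleK_coordOpK]

variable (B : B9.Backgrounds) (cfg : B.Cfg → CfgY 𝔸 i)

/-- ★ **`J†_ν(U₁)` IN COORDINATES** (bonds `XBK` → sites `XSK`, slice-PRESERVING): `coordOpKH b (fun _ => J†_ν(U₁))` — the operator the N06 certificate reads as the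
kinematic letter `JT ν` of `B9Thm33G0DivRFromDir` once `Dvstar` is pinned to def-Y's `DvscoKH`. [cite: Balaban1985BackgroundPropagators, (3.8) p.392, (3.124) p.420; Balaban1984PropagatorsII, (2.51) p.232] -/
def JTcoKH (ν : Fin (d + 1)) (U₁ : B.Cfg) : (XBK κ i → ℝ) →ₗ[ℝ] (XSK κ i → ℝ) :=
  coordOpKH b (fun _ : Fin (d + 1) => (JTb i (cfg U₁) ν).restrictScalars ℝ)

/-- `JTcoKH`, evaluated: the coordinate `c` of `J†_ν(U₁)` applied to the re-assembled `(slot, ·, c′)`-slice. [cite: Balaban1985BackgroundPropagators, (3.8) p.392, dictionary] -/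
theorem JTcoKH_apply (ν : Fin (d + 1)) (U₁ : B.Cfg) (F : XBK κ i → ℝ) (q : XSK κ i) :
    JTcoKH i b B cfg ν U₁ F q = b.repr (JTb i (cfg U₁) ν (assembleK b q.2.1 q.2.2.2 F) q.1) q.2.2.1 := rfl

/-- ★★ **THE CERTIFICATE'S `hDs` AT THE PINS: `DvscoKH = Σ_ν JTcoKH ν ∘ coordOpK b (fun _ => ∇_{U,ν})`** — def-Y's model of the gauge-sector `D*_U` (`hDvsco12`) IS
the sum over the directions of the transposed readings composed with the bond-sector direction letters `(𝔡A x).Dd U ν = coordOpK b (fun _ => cdBₗ U ν)` (`h𝔡Ad`).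
[cite: Balaban1985BackgroundPropagators, (3.8) p.392, (3.3) p.390, p.398 (remark after (3.47)), (3.124) p.420] -/
theorem DvscoKH_eq_sum (U₁ : B.Cfg) :
    DvscoKH i b B cfg U₁ = ∑ ν : Fin (d + 1), JTcoKH i b B cfg ν U₁ ∘ₗ coordOpK b (fun _ : Fin (d + 1) => cdBₗ i (cfg U₁) ν) := by
  calc DvscoKH i b B cfg U₁ = coordOpKH b (fun _ : Fin (d + 1) => (divY i (cfg U₁)).restrictScalars ℝ) := rfl
    _ = coordOpKH b (fun _ : Fin (d + 1) => ∑ ν : Fin (d + 1), (JTb i (cfg U₁) ν).restrictScalars ℝ ∘ₗ cdBₗ i (cfg U₁) ν) := by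
        rw [divY_restrict_eq_sum]
    _ = ∑ ν : Fin (d + 1), coordOpKH b (fun _ : Fin (d + 1) => (JTb i (cfg U₁) ν).restrictScalars ℝ ∘ₗ cdBₗ i (cfg U₁) ν) :=
        coordOpKH_fsum b Finset.univ (fun ν (_ : Fin (d + 1)) => (JTb i (cfg U₁) ν).restrictScalars ℝ ∘ₗ cdBₗ i (cfg U₁) ν)
    _ = _ := by simp only [JTcoKH, coordOpKH_comp_coordOpK]

end Coords

/-! ## §3 The sup majorant of `J†_ν`: one transported neighbour value, within `rJ` index blocks -/

section Sup

variable {κ : Type} [Fintype κ] (b : Module.Basis κ ℝ 𝔸) [FiniteDimensional ℝ 𝔸] (B : B9.Backgrounds) (cfg : B.Cfg → CfgY 𝔸 i)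
variable {bI : FBondY i → IBondY i}

omit [NormedAlgebra ℂ 𝔸] [CompleteSpace 𝔸] [FiniteDimensional ℝ 𝔸] in
/-- A unit that is a norm contraction together with its inverse conjugates contractively by its inverse too: `‖g⁻¹ v g‖ ≤ ‖v‖`. [folklore] -/
private theorem norm_R_inv_le_of_contraction {g : 𝔸ˣ} (h1 : ‖(g : 𝔸)‖ ≤ 1) (h2 : ‖((g⁻¹ : 𝔸ˣ) : 𝔸)‖ ≤ 1) (v : 𝔸) :
    ‖R g⁻¹ v‖ ≤ ‖v‖ := by
  unfold R
  rw [inv_inv]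
  calc ‖((g⁻¹ : 𝔸ˣ) : 𝔸) * v * (g : 𝔸)‖ ≤ ‖((g⁻¹ : 𝔸ˣ) : 𝔸) * v‖ * ‖(g : 𝔸)‖ := norm_mul_le _ _
    _ ≤ (‖((g⁻¹ : 𝔸ˣ) : 𝔸)‖ * ‖v‖) * ‖(g : 𝔸)‖ := mul_le_mul_of_nonneg_right (norm_mul_le _ _) (norm_nonneg _)
    _ ≤ (1 * ‖v‖) * 1 := mul_le_mul (mul_le_mul_of_nonneg_right h2 (norm_nonneg _)) h1 (norm_nonneg _) (by positivity)
    _ = ‖v‖ := by ring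

/-- ★ **THE POINTWISE BOUND**: for contracting link variables, `|(J†_νF)(z, slot, c, c′)| ≤ coordBound·basisBound·Σ_a |F(⟨chart⁻¹z − e_ν, ν⟩, slot, a, c′)|` (the
coordinate of a vector is `≤ coordBound·‖·‖`, the inverse conjugation contracts, the re-assembled slice has norm `≤ basisBound·Σ_a|F_a|`).
[cite: Balaban1985BackgroundPropagators, (3.8) p.392, (3.35) p.396 («U has values in G»), p.389 (coordinates), dictionary] -/
theorem abs_JTcoKH_apply_le (ν : Fin (d + 1)) (U₁ : B.Cfg)
    (hU : ∀ (μ : Fin (d + 1)) (s : Site (PV d ℓ i.m i.K hd hL) 0), ‖(cfg U₁ μ s : 𝔸)‖ ≤ 1 ∧ ‖(((cfg U₁ μ s)⁻¹ : 𝔸ˣ) : 𝔸)‖ ≤ 1)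
    (F : XBK κ i → ℝ) (q : XSK κ i) :
    |JTcoKH i b B cfg ν U₁ F q| ≤
      coordBound39 b * (basisBound39 b * ∑ a, |F (⟨((chartY i).symm q.1).unshift ν, ν⟩, q.2.1, a, q.2.2.2)|) := by
  have hcb : 0 ≤ coordBound39 b := norm_nonneg _
  rw [JTcoKH_apply, JTb_apply, map_neg, Finsupp.neg_apply, abs_neg]
  refine (abs_repr_le b _ _).trans (mul_le_mul_of_nonneg_left ?_ hcb)
  exact (norm_R_inv_le_of_contraction (hU ν _).1 (hU ν _).2 _).trans (norm_sum_smul_basis_le b _)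

/-- ★★ **THE SUP MAJORANT OF `J†_ν(U₁)`, TWO-SPACE FORM**: from the bond carrier `XBK` (block map `blkBK bI`) to the site carrier `XSK` (block map `blkSK (sIK bI)`), for `bI`
1-faithful and contracting link variables, `J†_ν(U₁)` has the [4]-(2.51) majorant `cR39 b·e^{δ·rJ}·e^{−δd(y,y′)}` for every `δ ≥ 0`: `|(J†_νF)(q)| ≤ cR39 b·|F|`, and the value
at `q` reads `F` only on the index block of the back-shifted bond, within `rJ` of the site block `sIK bI q.1`.
[cite: Balaban1985BackgroundPropagators, (3.8) p.392, (3.35) p.396, (3.124) p.420; Balaban1984PropagatorsII, (2.45)–(2.46) p.231, (2.51) p.232] -/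
theorem hasMajorantHom_JTcoKH
    (hβ1 : ∀ f : FBondY i, (geomT i.D).dist (β i.hN i.D i.hk (bI f)) (blkV1 i.hN i.D f) ≤ 1) {U₁ : B.Cfg}
    (hU : ∀ (μ : Fin (d + 1)) (s : Site (PV d ℓ i.m i.K hd hL) 0), ‖(cfg U₁ μ s : 𝔸)‖ ≤ 1 ∧ ‖(((cfg U₁ μ s)⁻¹ : 𝔸ˣ) : 𝔸)‖ ≤ 1)
    {δ : ℝ} (hδ : 0 ≤ δ) (R₀ : ℝ) (H₀ : Prop) [Fintype (geo9K i).Site] (ν : Fin (d + 1)) :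
    HasMajorantHom (g := toB6 (geo9K i) R₀ H₀) (blkBK i bI) (blkSK i (sIK i bI)) (JTcoKH i b B cfg ν U₁)
      (fun a a' => cR39 b * (Real.exp (δ * rJ d ℓ) * Real.exp (-(δ * (geo9K i).dist a a')))) := by
  intro y' F Bl hl q
  change IBondY i at y'
  set s : Site (PV d ℓ i.m i.K hd hL) 0 := ((chartY i).symm q.1).unshift ν with hs
  have hpt := abs_JTcoKH_apply_le i b B cfg ν U₁ hU F q
  have hK0 : 0 ≤ cR39 b * (Real.exp (δ * rJ d ℓ) * Real.exp (-(δ * (geo9K i).dist (blkSK i (sIK i bI) q) y'))) := by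
    have := cR39_nonneg b
    positivity
  by_cases hsrc : bI ⟨s, ν⟩ = y'
  · -- the input block is the index block of the back-shifted bond
    have hsum : ∑ a, |F (⟨s, ν⟩, q.2.1, a, q.2.2.2)| ≤ (Fintype.card κ : ℝ) * Bl := by
      calc ∑ a, |F (⟨s, ν⟩, q.2.1, a, q.2.2.2)| ≤ ∑ _a : κ, Bl := Finset.sum_le_sum fun a _ => hl.bound (⟨s, ν⟩, q.2.1, a, q.2.2.2) hsrc
        _ = (Fintype.card κ : ℝ) * Bl := by rw [Finset.sum_const, nsmul_eq_mul, Finset.card_univ]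
    have hval : |JTcoKH i b B cfg ν U₁ F q| ≤ cR39 b * Bl := by
      refine hpt.trans ?_
      have hcb : 0 ≤ coordBound39 b := norm_nonneg _
      have hbb : 0 ≤ basisBound39 b := Finset.sum_nonneg fun _ _ => norm_nonneg _
      calc coordBound39 b * (basisBound39 b * ∑ a, |F (⟨s, ν⟩, q.2.1, a, q.2.2.2)|)
          ≤ coordBound39 b * (basisBound39 b * ((Fintype.card κ : ℝ) * Bl)) :=
            mul_le_mul_of_nonneg_left (mul_le_mul_of_nonneg_left hsum hbb) hcb
        _ = cR39 b * Bl := by simp only [cR39]; ring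
    have hnear : (geo9K i).dist (blkSK i (sIK i bI) q) y' ≤ rJ d ℓ := by
      -- the site block of `q.1 = chart(s + e_ν)` and the index block of `⟨s, ν⟩`
      have hq : q.1 = chartY i (s.shift ν) := by
        rw [hs, shift_unshift, Equiv.apply_symm_apply]
      have h1 := dist_bI_sIK_shift_le i hβ1 s ν ν
      rw [← hsrc]
      show (geo9K i).dist (sIK i bI q.1) (bI ⟨s, ν⟩) ≤ rJ d ℓ
      rw [hq, B9GeoLemma21KLevelV1.geo9K_dist_comm]
      exact h1
    have hK1 : 1 ≤ Real.exp (δ * rJ d ℓ) * Real.exp (-(δ * (geo9K i).dist (blkSK i (sIK i bI) q) y')) := by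
      rw [← Real.exp_add]
      refine Real.one_le_exp ?_
      nlinarith [mul_le_mul_of_nonneg_left hnear hδ]
    calc |JTcoKH i b B cfg ν U₁ F q| ≤ cR39 b * Bl := hval
      _ = cR39 b * 1 * Bl := by rw [mul_one]
      _ ≤ cR39 b * (Real.exp (δ * rJ d ℓ) * Real.exp (-(δ * (geo9K i).dist (blkSK i (sIK i bI) q) y'))) * Bl :=
          mul_le_mul_of_nonneg_right (mul_le_mul_of_nonneg_left hK1 (cR39_nonneg b)) hl.nonneg
  · -- the input vanishes at the back-shifted bond
    have h0 : ∑ a, |F (⟨s, ν⟩, q.2.1, a, q.2.2.2)| = 0 :=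
      Finset.sum_eq_zero fun a _ => by rw [hl.off (⟨s, ν⟩, q.2.1, a, q.2.2.2) hsrc, abs_zero]
    rw [h0, mul_zero, mul_zero] at hpt
    exact hpt.trans (mul_nonneg hK0 hl.nonneg)

/-- ★★ **THE SUP MAJORANT OF `J†_ν(U₁)`, CLASS FORM** (the `hJT` input of `B9Thm33G0DivRFromDir.h44Ds_of_h44m`): from the sharp block-sup size of the bond carrier into
`𝔠_W⁽⁰⁾`, `HasMaj (ofBlocks (blkBK bI)) (cNormR R₀ H₀ (blkSK (sIK bI)) _ 0) (J†_ν(U₁)) (cR39 b·e^{δ·rJ}·e^{−δd})`, every `δ ≥ 0`.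
[cite: Balaban1985BackgroundPropagators, (3.8) p.392, (3.42) p.397, (3.124) p.420; Balaban1984PropagatorsII, (2.51) p.232] -/
theorem hasMaj_JTcoKH
    (hβ1 : ∀ f : FBondY i, (geomT i.D).dist (β i.hN i.D i.hk (bI f)) (blkV1 i.hN i.D f) ≤ 1) {U₁ : B.Cfg}
    (hU : ∀ (μ : Fin (d + 1)) (s : Site (PV d ℓ i.m i.K hd hL) 0), ‖(cfg U₁ μ s : 𝔸)‖ ≤ 1 ∧ ‖(((cfg U₁ μ s)⁻¹ : 𝔸ˣ) : 𝔸)‖ ≤ 1)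
    {δ : ℝ} (hδ : 0 ≤ δ) {R₀ : ℝ} {H₀ : Prop} [Fintype (geo9K i).Site] (hlen : ∀ y : (geo9K i).Site, 0 ≤ (geo9K i).len y)
    (ν : Fin (d + 1)) :
    HasMaj (BlockNorm.ofBlocks (toB6 (geo9K i) R₀ H₀) (blkBK i bI)) (cNormR R₀ H₀ (blkSK i (sIK i bI)) hlen 0) (JTcoKH i b B cfg ν U₁)
      (fun a a' => cR39 b * Real.exp (δ * rJ d ℓ) * Real.exp (-(δ * (geo9K i).dist a a'))) := by
  have hK0 : ∀ a a' : (geo9K i).Site, 0 ≤ cR39 b * (Real.exp (δ * rJ d ℓ) * Real.exp (-(δ * (geo9K i).dist a a'))) :=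
    fun a a' => by have := cR39_nonneg b; positivity
  have h0 := B9Thm37AllNorms.hasMaj_of_hasMajorantHom (G := toB6 (geo9K i) R₀ H₀) (blkBK i bI) (blkSK i (sIK i bI)) hK0
    (hasMajorantHom_JTcoKH i b B cfg hβ1 hU hδ R₀ H₀ ν)
  intro y' F hF y
  rw [cNormR_loc, Real.rpow_zero, one_mul]
  refine (h0 y' F hF y).trans (le_of_eq ?_)
  ring

end Sup

/-! ## §4 The input Hölder family grows with its exponent; the letters at node00-def-Y's members -/

section Input

variable {κ : Type} [Fintype κ] [DecidableEq κ] {bI : FBondY i → IBondY i} [Fintype (geo9K i).Site] [DecidableRel (RelB i)]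

omit [NormedAlgebra ℂ 𝔸] [CompleteSpace 𝔸] [DecidableEq κ] [Fintype (geo9K i).Site] in
/-- **the ξ-Hölder part of the input norm grows with its exponent**: on `Adm` pairs `tpar ≤ 1`, so `tpar^{−ε} ≤ tpar^{−ε′}` for `0 < ε ≤ ε′`.
[cite: Balaban1985BackgroundPropagators, (3.40) p.397 (bookkeeping); Balaban1984PropagatorsII, (2.137) p.247] -/
theorem holK_mono {ε ε' : ℝ} (hε : 0 < ε) (hεε' : ε ≤ ε') (y : IBondY i) (F : XBK κ i → ℝ) :
    holK (κ := κ) i bI ε y F ≤ holK i bI ε' y F := by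
  unfold holK
  refine ciSup_mono (Finite.bddAbove_range _) fun q => ?_
  by_cases h : Adm i q.1.1 q.1.2 ∧ RelB i (bI q.1.1) y
  · rw [if_pos h, if_pos h]
    refine mul_le_mul_of_nonneg_right ?_ (abs_nonneg _)
    rcases (tpar_nonneg i q.1.1 q.1.2).eq_or_lt with h0 | hpos
    · rw [← h0, Real.zero_rpow (neg_ne_zero.mpr hε.ne'), Real.zero_rpow (neg_ne_zero.mpr (hε.trans_le hεε').ne')]
    · exact Real.rpow_le_rpow_of_exponent_ge hpos (tpar_le_one i h.1) (neg_le_neg hεε')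
  · rw [if_neg h, if_neg h]

omit [NormedAlgebra ℂ 𝔸] [CompleteSpace 𝔸] [DecidableEq κ] in
/-- ★ **THE INPUT FAMILY `bHK` IS DOMINATED UPWARDS IN ITS EXPONENT** (the `hdom` input of `B9Thm33G0DivRFromDir.h44Ds_of_h44m`): for `1 ≤ ε` the localisation of `bHK ε` is that
of `bHK 1` and `(bHK 1).loc ≤ (bHK ε).loc`. [cite: Balaban1985BackgroundPropagators, (3.40) p.397 + (3.44) p.398 (bookkeeping)] -/
theorem bHK_dom {R : ℝ} {H : Prop} (ε : ℝ) (hε : 1 ≤ ε) :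
    (∀ (y : IBondY i) (F : XBK κ i → ℝ), (bHK (R := R) (H := H) i bI ε).IsLoc y F → (bHK (R := R) (H := H) i bI 1).IsLoc y F) ∧
      (∀ (y : IBondY i) (F : XBK κ i → ℝ), (bHK (R := R) (H := H) i bI 1).loc y F ≤ (bHK (R := R) (H := H) i bI ε).loc y F) :=
  ⟨fun _ _ h => h, fun y F => add_le_add le_rfl (holK_mono i one_pos hε y F)⟩

end Input

section Members

open scoped Matrix.Norms.L2Operator
open B7Prop2SpecialUnitary (specialUnitaryUnits)
open B9PinMembersKLevelV1 (MemberY geo9Y bg9Y)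
open B9CoReadingCoordsTranspose (TrIdx trBasis)

variable {Mstar : ℕ} {N : ℕ} [NeZero N]
variable [∀ x : MemberY d ℓ hd hL b₀ b₁ Mstar, Fintype (geo9Y x).Site]

/-- ★★ **THE SUP LETTER `J†_ν(U)` AT THE CERTIFICATE'S PINS, EVERY MEMBER, EVERY REGULAR `U`** (the knit's `hJT x U ν`): at
`JTcoKH x.toKIdx (trBasis N) (bg9Y …) (fun U => U) ν U`, block maps `blkBK (bI x)` (`hblk12`) ∕ `blkSK (sIK (bI x))` (`hblkW12`), `bI` 1-faithful (`hβ1`):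
`HasMaj (ofBlocks (blkBK bI)) (cNormR R₀ H₀ (blkSK (sIK bI)) _ 0) (J†_ν(U)) (cR39 (trBasis N)·e^{δ·rJ}·e^{−δd})`, every `δ ≥ 0`.
[cite: Balaban1985BackgroundPropagators, (3.8) p.392, (3.35) p.396, (3.42) p.397, (3.124) p.420; Balaban1984PropagatorsII, (2.51) p.232] -/
theorem hasMaj_JTcoKH_pins (x : MemberY d ℓ hd hL b₀ b₁ Mstar) {bI : FBondY x.toKIdx → IBondY x.toKIdx}
    (hβ1 : ∀ f : FBondY x.toKIdx, (geomT x.D).dist (β x.hN x.D x.hk (bI f)) (blkV1 x.hN x.D f) ≤ 1) {c α₀ : ℝ}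
    {U : (bg9Y (Matrix (Fin N) (Fin N) ℂ) (specialUnitaryUnits (Fin N)) x).Cfg}
    (hU : (bg9Y (Matrix (Fin N) (Fin N) ℂ) (specialUnitaryUnits (Fin N)) x).Reg335 c α₀ U)
    {δ : ℝ} (hδ : 0 ≤ δ) {R₀ : ℝ} {H₀ : Prop} (hlen : ∀ y : (geo9Y x).Site, 0 ≤ (geo9Y x).len y) (ν : Fin (d + 1)) :
    HasMaj (BlockNorm.ofBlocks (toB6 (geo9Y x) R₀ H₀) (blkBK x.toKIdx bI)) (cNormR R₀ H₀ (blkSK x.toKIdx (sIK x.toKIdx bI)) hlen 0)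
      (JTcoKH x.toKIdx (trBasis N) (bg9Y (Matrix (Fin N) (Fin N) ℂ) (specialUnitaryUnits (Fin N)) x) (fun U => U) ν U)
      (fun a a' => cR39 (trBasis N) * Real.exp (δ * rJ d ℓ) * Real.exp (-(δ * (geo9Y x).dist a a'))) := by
  letI : Fintype (geo9K x.toKIdx).Site := (inferInstance : Fintype (geo9Y x).Site)
  exact hasMaj_JTcoKH x.toKIdx (trBasis N) (bg9Y (Matrix (Fin N) (Fin N) ℂ) (specialUnitaryUnits (Fin N)) x) (fun U => U)
    hβ1 (cfg_norm_le_one_of_reg335 x hU) hδ hlen ν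

end Members

end Literature.MathematicalPhysics.QuantumFieldTheory.Balaban1983to89.B9DivViaGradLettersAtPins

end
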